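import Summits.CriticalPhenomena.PercolationContinuityZ3.Theorems.PercNearOneGluingNoHeavyQuantIndepBlobCloudComponents
import Summits.CriticalPhenomena.PercolationContinuityZ3.Theorems.PercNearOneGluingNoHeavyQuantDIBStarCorner
import Summits.CriticalPhenomena.PercolationContinuityZ3.Theorems.PercNearOneGluingNoHeavyQuantTwoPointMeanMixture
import HarnessLib

/-!
# QUANT lane R8, Conjecture DIB\* — the CLOUD-DECOMPOSITION CERTIFICATE (LIGHT-DEC, unconditional) and DIB\* for SMALL LIGHT
# CLOUDS: any number of light blobs whose sizes TOTAL at most `j`, every floor `0 < x < 1` (part II of `…QuantIndepBlobCloudComponents`)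

builds on p205010 (kernel theorem, internal audit signed; external expert review pending)

Support file (`--supports stmt-CriticalPhenomena-4575`), QUANT lane census seat prim-quant-census-1 (gen 15), rung R8 of
`run/shared/lean/prim/quant/LADDER.md`; memo `run/shared/lean/prim/quant/prim-quant-census-1/SMALL-CLOUD-G15.md`.
Theorems only, no definitions, no sorries, standard axioms.

STATUS BEFORE.  Conjecture DIB\* (`Quant.IndepBlob.DIBStar`) is kernel at floors `≤ 1/2`, off the corner, with EXACTLY ONE light blob
(`IndepBlob.dib_oneLight`, census-1 g14), for mergeable clouds (p1 g11) and matched companions (lead g16); open = the corner with `≥ 2`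
non-empty light blobs (`Quant.IndepBlob.DIBStarCorner`, typer g17/g18).  Vocabulary as in part (I): a CLOUD `L` (the other blobs heavy,
`x ≤ p k`), cloud size `M = Σ_{k ∈ L} a k`, cloud mean `m = Σ_{k ∈ L} a k·p k`, cloud law `μ(h) = P(a(S ∩ L) = h)`, heavy budget
`C_H = Σ_{k ∉ L} a k·p k`; a COMPONENT `(lo, hi, γ)` = 'sure `lo` + one blob `(hi − lo, γ)`'.

* `Quant.IndepBlob.cloud_bracket_ge` — the component row of part (I) with the full certificate MENU: (β) `lo ≥ j+1`; (α) heavy giant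
  `x ≤ γ`, `hi ≥ j+1`; (γ′) credit `2j < C_H + 2·lo + [(hi − lo)·γ if x ≤ γ, else (min(hi, j) − lo)·max(κ_x(γ), 0)]` (light giants CAPPED
  to size `j − lo`, sub-`x²` lights dropped) ⟹ `x ≤ γ·TL_{Lᶜ}(j+1−hi) + (1 − γ)·TL_{Lᶜ}(j+1−lo)`.
* `Quant.IndepBlob.tail_ge_of_cloudDec` — **THE CLOUD-DECOMPOSITION CERTIFICATE (LIGHT-DEC)**: if the cloud law is a finite mixture
  `μ = Σ_r w_r·TP[lo_r, hi_r, γ_r]` (atoms `lo ≤ hi ≤ M`, gates in `[0,1]`, `w ≥ 0`) whose genuine components are certified by the menu,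
  then `x ≤ P(N ≥ j+1)`.  UNCONDITIONAL (every component is a one-light instance; contrast `RootDec.rtail_ge_of_decCert`, whose light
  certificate γ assumes `DIBWith`).  Census (memo §3, `code/g15/conelp.py`): the certificate is an LP in `w`; it is FEASIBLE on every one
  of 29 087 random + 217 exact DIB\*-corner clouds at the hardest admissible heavy budget, and infeasible on DIB\*-false data — numerically
  the multi-light corner of DIB\* is EQUIVALENT to the existence of such a decomposition of the light cloud's law (Conjecture LIGHT-DEC).
* `Quant.IndepBlob.tail_ge_of_smallCloud` — **floor `0 < x < 1`, cloud gates `≤ x`, cloud size `M ≤ j`, credit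
  `2j < C_H + (m − x²·M)/(1 − x)` ⟹ `x ≤ P(N ≥ j+1)`**: the mean-preserving decomposition of `μ` (census-2 g50's
  `TAMP.exists_twoPoint_mixture_mean`) is certified by (γ′) through part (I)'s `cloudCredit_le_component`.
* `Quant.IndepBlob.dibStar_of_lightTotal_le` — **Conjecture DIB\* in its own binder shape for EVERY instance whose light blobs total
  `≤ j`** (instead of `a k ≤ j` blob by blob): any number of lights, every floor `0 < x < 1` — the family 'small clouds' of the open corner.

[this work; this lane's census]; the gluing rows served: [cite: KozmaNitzan2024, Conjecture 3 (p. 15)]; product weights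
[cite: Grimmett1999, §1.3 p. 10].
-/

namespace Summit.CriticalPhenomena.PercolationContinuityZ3.Theorems

namespace Quant

namespace IndepBlob

open Finset

variable {κ : Type*} [Fintype κ] [DecidableEq κ]

/-! ### 3. The certificate menu for one component -/

/-- **The component bracket under the full certificate menu** (β / α / γ′ with capping).  See the module docstring. [this work] -/
theorem cloud_bracket_ge (p : κ → ℝ) (a : κ → ℕ) (x : ℝ) (hx0 : 0 < x) (hx1 : x < 1)
    (hp0 : ∀ k, 0 ≤ p k) (hp1 : ∀ k, p k ≤ 1) (L : Finset κ) (ℓ₀ : κ) (hℓ₀ : ℓ₀ ∈ L)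
    (hheavy : ∀ k, k ∉ L → x ≤ p k) (j lo hi : ℕ) (γ : ℝ) (hγ0 : 0 ≤ γ) (hγ1 : γ ≤ 1) (hlohi : lo ≤ hi)
    (hcert : j + 1 ≤ lo ∨ (x ≤ γ ∧ j + 1 ≤ hi) ∨
      (2 * j : ℝ) < (∑ k ∈ Finset.univ \ L, (a k : ℝ) * p k) + 2 * lo +
        (if x ≤ γ then ((hi - lo : ℕ) : ℝ) * γ else ((min hi j - lo : ℕ) : ℝ) * max ((γ - x ^ 2) / (1 - x)) 0)) :
    x ≤ γ * (∑ T ∈ (Finset.univ \ L).powerset, (∏ k ∈ Finset.univ \ L, if k ∈ T then p k else 1 - p k) *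
            (if j + 1 - hi ≤ ∑ k ∈ T, a k then (1 : ℝ) else 0)) +
        (1 - γ) * (∑ T ∈ (Finset.univ \ L).powerset, (∏ k ∈ Finset.univ \ L, if k ∈ T then p k else 1 - p k) *
            (if j + 1 - lo ≤ ∑ k ∈ T, a k then (1 : ℝ) else 0)) := by
  set U : Finset κ := Finset.univ \ L with hU
  set TL : ℕ → ℝ := fun t => ∑ T ∈ U.powerset, (∏ k ∈ U, if k ∈ T then p k else 1 - p k) *
      (if t ≤ ∑ k ∈ T, a k then (1 : ℝ) else 0) with hTL
  change x ≤ γ * TL (j + 1 - hi) + (1 - γ) * TL (j + 1 - lo)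
  have hTL0 : TL 0 = 1 := tailU_zero p a U
  have hTLnn : ∀ t, 0 ≤ TL t := fun t => tailU_nonneg p a U (fun k _ => hp0 k) (fun k _ => hp1 k) t
  have hTL1 : ∀ t, TL t ≤ 1 := fun t => tailU_le_one p a U (fun k _ => hp0 k) (fun k _ => hp1 k) t
  have hTLanti : ∀ {t t' : ℕ}, t ≤ t' → TL t' ≤ TL t := fun htt =>
    tailU_antitone p a U (fun k _ => hp0 k) (fun k _ => hp1 k) htt
  have h1γ : 0 ≤ 1 - γ := by linarith
  -- the component row of part (I), for `lo' ≤ hi' ≤ j`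
  have hrow : ∀ lo' hi' : ℕ, lo' ≤ hi' → hi' ≤ j →
      (2 * j : ℝ) < (∑ k ∈ Finset.univ \ L, (a k : ℝ) * p k) + 2 * lo' +
        ((hi' - lo' : ℕ) : ℝ) * (if x ≤ γ then γ else (γ - x ^ 2) / (1 - x)) →
      x ≤ γ * TL (j + 1 - hi') + (1 - γ) * TL (j + 1 - lo') := fun lo' hi' h1 h2 h3 =>
    cloud_component_row p a x hx0 hx1 hp0 hp1 L ℓ₀ hℓ₀ hheavy j lo' hi' γ hγ0 hγ1 h1 h2 h3
  rcases hcert with hβ | ⟨hxγ, hgiant⟩ | hcr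
  · -- (β): both levels are `0`
    have e1 : j + 1 - hi = 0 := by omega
    have e2 : j + 1 - lo = 0 := by omega
    rw [e1, e2, hTL0]; nlinarith
  · -- (α): a heavy giant
    have e1 : j + 1 - hi = 0 := by omega
    rw [e1, hTL0]
    nlinarith [hTLnn (j + 1 - lo)]
  · by_cases hloj : j + 1 ≤ lo
    · have e1 : j + 1 - hi = 0 := by omega
      have e2 : j + 1 - lo = 0 := by omega
      rw [e1, e2, hTL0]; nlinarith
    by_cases hα : x ≤ γ ∧ j + 1 ≤ hi
    · have e1 : j + 1 - hi = 0 := by omega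
      rw [e1, hTL0]
      nlinarith [hTLnn (j + 1 - lo)]
    push Not at hloj
    have hloj' : lo ≤ j := by omega
    by_cases hxγ : x ≤ γ
    · -- heavy, not a giant: `hi ≤ j`
      have hhij : hi ≤ j := by
        by_contra h
        exact hα ⟨hxγ, by omega⟩
      rw [if_pos hxγ] at hcr
      exact hrow lo hi hlohi hhij (by rw [if_pos hxγ]; exact hcr)
    · -- light: cap the blob at size `j − lo`, drop it if its rate is negative
      rw [if_neg hxγ] at hcr
      have hhi'le : min hi j ≤ hi := Nat.min_le_left _ _
      have hhi'j : min hi j ≤ j := Nat.min_le_right _ _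
      have hlohi' : lo ≤ min hi j := le_min hlohi hloj'
      have hmono : TL (j + 1 - min hi j) ≤ TL (j + 1 - hi) := hTLanti (Nat.sub_le_sub_left hhi'le _)
      have hstep : x ≤ γ * TL (j + 1 - min hi j) + (1 - γ) * TL (j + 1 - lo) := by
        by_cases hκ : 0 ≤ (γ - x ^ 2) / (1 - x)
        · rw [max_eq_left hκ] at hcr
          exact hrow lo (min hi j) hlohi' hhi'j (by rw [if_neg hxγ]; exact hcr)
        · push Not at hκ
          rw [max_eq_right hκ.le, mul_zero] at hcr
          have h0 := hrow lo lo le_rfl hloj' (by rw [Nat.sub_self, Nat.cast_zero, zero_mul]; linarith)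
          have hm : TL (j + 1 - lo) ≤ TL (j + 1 - min hi j) := hTLanti (Nat.sub_le_sub_left hlohi' _)
          linarith [mul_le_mul_of_nonneg_left hm hγ0]
      linarith [mul_le_mul_of_nonneg_left hmono hγ0]

/-! ### 4. The cloud-decomposition certificate -/

/-- **THE CLOUD-DECOMPOSITION CERTIFICATE (LIGHT-DEC).**  Gates in `[0,1]`, floor `0 < x < 1`, a cloud `L` off which every blob is
heavy; mixture data `(w, lo, hi, γ)` on a finite index type with `w ≥ 0`, `lo ≤ hi ≤ M = Σ_{k ∈ L} a k`, gates in `[0,1]`, reproducing the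
cloud law: `P(a(S ∩ L) = h) = Σ_r w_r·TP[lo_r, hi_r, γ_r](h)` for every `h`; every genuine component (`w_r > 0`) certified by (β) / (α) /
(γ′) of `cloud_bracket_ge`.  Then `x ≤ P(N ≥ j+1)`. [this work] -/
theorem tail_ge_of_cloudDec {ρ : Type*} [Fintype ρ] (p : κ → ℝ) (a : κ → ℕ) (x : ℝ) (hx0 : 0 < x) (hx1 : x < 1)
    (hp0 : ∀ k, 0 ≤ p k) (hp1 : ∀ k, p k ≤ 1) (L : Finset κ) (hheavy : ∀ k, k ∉ L → x ≤ p k) (j : ℕ)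
    (w : ρ → ℝ) (lo hi : ρ → ℕ) (γ : ρ → ℝ) (hw0 : ∀ r, 0 ≤ w r) (hlohi : ∀ r, lo r ≤ hi r)
    (hhi : ∀ r, hi r ≤ ∑ k ∈ L, a k) (hγ : ∀ r, 0 ≤ γ r ∧ γ r ≤ 1)
    (hmix : ∀ h : ℕ, ∑ S ∈ L.powerset.filter (fun S => ∑ k ∈ S, a k = h), (∏ k ∈ L, if k ∈ S then p k else 1 - p k) =
      ∑ r, w r * (γ r * (if h = hi r then (1 : ℝ) else 0) + (1 - γ r) * (if h = lo r then (1 : ℝ) else 0)))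
    (hcert : ∀ r, 0 < w r → j + 1 ≤ lo r ∨ (x ≤ γ r ∧ j + 1 ≤ hi r) ∨
      (2 * j : ℝ) < (∑ k ∈ Finset.univ \ L, (a k : ℝ) * p k) + 2 * lo r +
        (if x ≤ γ r then ((hi r - lo r : ℕ) : ℝ) * γ r
          else ((min (hi r) j - lo r : ℕ) : ℝ) * max ((γ r - x ^ 2) / (1 - x)) 0)) :
    x ≤ ∑ s : Finset κ, (∏ k, if k ∈ s then p k else 1 - p k) * (if j + 1 ≤ ∑ k ∈ s, a k then (1 : ℝ) else 0) := by
  set U : Finset κ := Finset.univ \ L with hU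
  set TL : ℕ → ℝ := fun t => ∑ T ∈ U.powerset, (∏ k ∈ U, if k ∈ T then p k else 1 - p k) *
      (if t ≤ ∑ k ∈ T, a k then (1 : ℝ) else 0) with hTL
  set M : ℕ := ∑ k ∈ L, a k with hM
  set wL : Finset κ → ℝ := fun S => ∏ k ∈ L, if k ∈ S then p k else 1 - p k with hwL
  set μ : ℕ → ℝ := fun h => ∑ S ∈ L.powerset.filter (fun S => ∑ k ∈ S, a k = h), wL S with hμ
  -- the law of the cloud mass
  have hmaps : ∀ S ∈ L.powerset, (∑ k ∈ S, a k) ∈ Finset.range (M + 1) := fun S hS => by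
    rw [Finset.mem_range, Nat.lt_succ_iff]
    exact Finset.sum_le_sum_of_subset (Finset.mem_powerset.1 hS)
  have hfib : ∀ φ : ℕ → ℝ, ∑ S ∈ L.powerset, wL S * φ (∑ k ∈ S, a k) = ∑ h ∈ Finset.range (M + 1), μ h * φ h := by
    intro φ
    rw [← Finset.sum_fiberwise_of_maps_to hmaps]
    refine Finset.sum_congr rfl fun h _ => ?_
    simp only [hμ]
    rw [Finset.sum_mul]
    refine Finset.sum_congr rfl fun S hS => ?_
    rw [(Finset.mem_filter.1 hS).2]
  have hmix' : ∀ h, μ h = ∑ r, w r * (γ r * (if h = hi r then (1 : ℝ) else 0) + (1 - γ r) * (if h = lo r then (1 : ℝ) else 0)) :=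
    fun h => hmix h
  have hexp : ∀ φ : ℕ → ℝ, ∑ h ∈ Finset.range (M + 1), μ h * φ h = ∑ r, w r * (γ r * φ (hi r) + (1 - γ r) * φ (lo r)) := by
    intro φ
    calc ∑ h ∈ Finset.range (M + 1), μ h * φ h
        = ∑ h ∈ Finset.range (M + 1), ∑ r, w r * ((γ r * (if h = hi r then (1 : ℝ) else 0) +
            (1 - γ r) * (if h = lo r then (1 : ℝ) else 0)) * φ h) := by
          refine Finset.sum_congr rfl fun h _ => ?_
          rw [hmix' h, Finset.sum_mul]
          exact Finset.sum_congr rfl fun r _ => by ring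
      _ = ∑ r, ∑ h ∈ Finset.range (M + 1), w r * ((γ r * (if h = hi r then (1 : ℝ) else 0) +
            (1 - γ r) * (if h = lo r then (1 : ℝ) else 0)) * φ h) := Finset.sum_comm
      _ = ∑ r, w r * (γ r * φ (hi r) + (1 - γ r) * φ (lo r)) := by
          refine Finset.sum_congr rfl fun r _ => ?_
          have hloR : lo r ∈ Finset.range (M + 1) := by
            rw [Finset.mem_range, Nat.lt_succ_iff]; exact (hlohi r).trans (hhi r)
          have hhiR : hi r ∈ Finset.range (M + 1) := by
            rw [Finset.mem_range, Nat.lt_succ_iff]; exact hhi r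
          rw [← Finset.mul_sum, sum_TP_mul (Finset.range (M + 1)) (lo r) (hi r) hloR hhiR (γ r) φ]
  -- total weight one
  have hw1 : ∑ r, w r = 1 := by
    have h1 := hfib (fun _ => 1)
    have h2 := hexp (fun _ => 1)
    simp only [mul_one] at h1 h2
    have h3 : ∑ r, w r * (γ r + (1 - γ r)) = ∑ r, w r := Finset.sum_congr rfl fun r _ => by ring
    rw [← h3, ← h2, ← h1]
    exact sum_powerset_weight p L
  rcases L.eq_empty_or_nonempty with hL0 | ⟨ℓ₀, hℓ₀⟩
  · -- empty cloud: every genuine component is `(0, 0, γ)` and (γ′) is the heavy budget row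
    have hM0 : M = 0 := by rw [hM, hL0, Finset.sum_empty]
    obtain ⟨r, hr⟩ : ∃ r, 0 < w r := by
      by_contra h
      push Not at h
      have : ∑ r, w r ≤ 0 := Finset.sum_nonpos fun r _ => h r
      linarith
    have hhi0 : hi r = 0 := by have := hhi r; omega
    have hlo0 : lo r = 0 := by have := hlohi r; omega
    have hbudget : (2 * j : ℝ) < 2 * ((0 : ℕ) : ℝ) + ∑ k, (a k : ℝ) * p k := by
      rcases hcert r hr with hβ | ⟨-, hα⟩ | hcr
      · omega
      · omega
      · have hU0 : U = Finset.univ := by rw [hU, hL0, Finset.sdiff_empty]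
        rw [hlo0, hhi0, hU0] at hcr
        simp only [Nat.zero_min, Nat.sub_self, Nat.cast_zero, zero_mul, mul_zero, ite_self, add_zero] at hcr
        rw [Nat.cast_zero, mul_zero, zero_add]; exact hcr
    have hfloor : ∀ k, a k ≠ 0 → x ≤ p k := fun k _ => hheavy k (by rw [hL0]; exact Finset.notMem_empty k)
    have key := RootDec.term_ge_of_budget 0 a p j x hx1.le (fun k => ⟨hp0 k, hp1 k⟩) hfloor hbudget
    exact key.trans (le_of_eq (Finset.sum_congr rfl fun W _ => by rw [zero_add]))
  -- the tail as a mixture of component brackets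
  rw [tail_cloud_split p a L (j + 1)]
  change x ≤ ∑ S ∈ L.powerset, wL S * TL (j + 1 - ∑ k ∈ S, a k)
  rw [hfib (fun h => TL (j + 1 - h)), hexp (fun h => TL (j + 1 - h))]
  have hbr : ∀ r, w r * x ≤ w r * (γ r * TL (j + 1 - hi r) + (1 - γ r) * TL (j + 1 - lo r)) := by
    intro r
    rcases (hw0 r).eq_or_lt with h0 | hpos
    · rw [← h0, zero_mul, zero_mul]
    · exact mul_le_mul_of_nonneg_left (cloud_bracket_ge p a x hx0 hx1 hp0 hp1 L ℓ₀ hℓ₀ hheavy j (lo r) (hi r) (γ r)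
        (hγ r).1 (hγ r).2 (hlohi r) (hcert r hpos)) (hw0 r)
  calc x = ∑ r, w r * x := by rw [← Finset.sum_mul, hw1, one_mul]
    _ ≤ ∑ r, w r * (γ r * TL (j + 1 - hi r) + (1 - γ r) * TL (j + 1 - lo r)) := Finset.sum_le_sum fun r _ => hbr r

/-! ### 5. Small clouds -/

/-- **DIB\* FOR SMALL CLOUDS.**  Gates in `[0,1]`, floor `0 < x < 1`; a cloud `L` with gates `≤ x`, every other blob heavy; cloud size
`M = Σ_{k ∈ L} a k ≤ j`, cloud mean `m = Σ_{k ∈ L} a k·p k`; credit `2j < C_H + (m − x²·M)/(1 − x)`.  Then `x ≤ P(N ≥ j+1)`: the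
mean-preserving re-pairing of the cloud law (`TAMP.exists_twoPoint_mixture_mean`) is a certified decomposition (`cloudCredit_le_component`). [this work] -/
theorem tail_ge_of_smallCloud (p : κ → ℝ) (a : κ → ℕ) (x : ℝ) (hx0 : 0 < x) (hx1 : x < 1)
    (hp0 : ∀ k, 0 ≤ p k) (hp1 : ∀ k, p k ≤ 1) (L : Finset κ) (hheavy : ∀ k, k ∉ L → x ≤ p k)
    (hcloud : ∀ k ∈ L, p k ≤ x) (j : ℕ) (hsmall : ∑ k ∈ L, a k ≤ j)
    (hcredit : (2 * j : ℝ) < (∑ k ∈ Finset.univ \ L, (a k : ℝ) * p k) +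
      ((∑ k ∈ L, (a k : ℝ) * p k) - x ^ 2 * (∑ k ∈ L, (a k : ℝ))) / (1 - x)) :
    x ≤ ∑ s : Finset κ, (∏ k, if k ∈ s then p k else 1 - p k) * (if j + 1 ≤ ∑ k ∈ s, a k then (1 : ℝ) else 0) := by
  set M : ℕ := ∑ k ∈ L, a k with hM
  set m : ℝ := ∑ k ∈ L, (a k : ℝ) * p k with hm
  set wL : Finset κ → ℝ := fun S => ∏ k ∈ L, if k ∈ S then p k else 1 - p k with hwL
  set μ : ℕ → ℝ := fun h => ∑ S ∈ L.powerset.filter (fun S => ∑ k ∈ S, a k = h), wL S with hμ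
  have hmaps : ∀ S ∈ L.powerset, (∑ k ∈ S, a k) ∈ Finset.range (M + 1) := fun S hS => by
    rw [Finset.mem_range, Nat.lt_succ_iff]
    exact Finset.sum_le_sum_of_subset (Finset.mem_powerset.1 hS)
  have hfib : ∀ φ : ℕ → ℝ, ∑ S ∈ L.powerset, wL S * φ (∑ k ∈ S, a k) = ∑ h ∈ Finset.range (M + 1), μ h * φ h := by
    intro φ
    rw [← Finset.sum_fiberwise_of_maps_to hmaps]
    refine Finset.sum_congr rfl fun h _ => ?_
    simp only [hμ]
    rw [Finset.sum_mul]
    refine Finset.sum_congr rfl fun S hS => ?_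
    rw [(Finset.mem_filter.1 hS).2]
  have hμ0 : ∀ h, 0 ≤ μ h := fun h =>
    Finset.sum_nonneg fun S _ => weightU_nonneg p L (fun k _ => hp0 k) (fun k _ => hp1 k) S
  have hμsupp : ∀ h, h ∉ Finset.range (M + 1) → μ h = 0 := by
    intro h hh
    refine Finset.sum_eq_zero fun S hS => ?_
    exfalso
    have hS' := Finset.mem_filter.1 hS
    exact hh (hS'.2 ▸ hmaps S hS'.1)
  have hμ1 : ∑ h ∈ Finset.range (M + 1), μ h = 1 := by
    have h := hfib (fun _ => 1)
    simp only [mul_one] at h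
    rw [← h]
    exact sum_powerset_weight p L
  have hμmean : ∑ h ∈ Finset.range (M + 1), μ h * (h : ℝ) = m * ∑ h ∈ Finset.range (M + 1), μ h := by
    rw [hμ1, mul_one, ← hfib (fun h => (h : ℝ))]
    have h := sum_powerset_weight_mul_mass p a L
    simp only [Nat.cast_sum] at h ⊢
    exact h
  obtain ⟨n, lo, hi, γ, w, hcomp, hwsum, hmix⟩ :=
    TAMP.exists_twoPoint_mixture_mean (Finset.range (M + 1)) μ m hμ0 hμsupp hμmean
  have hmxM : m ≤ x * (M : ℝ) := by
    rw [hm, hM, Nat.cast_sum, Finset.mul_sum]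
    exact Finset.sum_le_sum fun k hk => by nlinarith [hcloud k hk, (Nat.cast_nonneg (a k) : (0 : ℝ) ≤ (a k : ℝ)), hp0 k]
  have hM' : (M : ℝ) = ∑ k ∈ L, (a k : ℝ) := by rw [hM, Nat.cast_sum]
  refine tail_ge_of_cloudDec p a x hx0 hx1 hp0 hp1 L hheavy j w lo hi γ (fun i => (hcomp i).2.2.2.2.2.1)
    (fun i => (hcomp i).2.2.1) (fun i => ?_) (fun i => ⟨(hcomp i).2.2.2.1, (hcomp i).2.2.2.2.1⟩) (fun h => hmix h) (fun i _ => ?_)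
  · have := Finset.mem_range.1 (hcomp i).2.1; omega
  · obtain ⟨hloR, hhiR, hlohi, hγ0, hγ1, -, hmean⟩ := hcomp i
    have hhiM : hi i ≤ M := by have := Finset.mem_range.1 hhiR; omega
    right; right
    have hc := cloudCredit_le_component x m (M : ℝ) (lo i : ℝ) (hi i : ℝ) (γ i) hx0 hx1 (Nat.cast_nonneg _)
      (Nat.cast_le.2 hlohi) (Nat.cast_le.2 hhiM) hγ0 hmean hmxM
    rw [hM'] at hc
    have hmin : min (hi i) j = hi i := Nat.min_eq_left (hhiM.trans hsmall)
    rw [hmin, Nat.cast_sub hlohi]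
    by_cases hxγ : x ≤ γ i
    · rw [if_pos hxγ] at hc ⊢; linarith
    · rw [if_neg hxγ] at hc ⊢
      have hb : (0 : ℝ) ≤ (hi i : ℝ) - (lo i : ℝ) := sub_nonneg.2 (Nat.cast_le.2 hlohi)
      have hmax : ((hi i : ℝ) - (lo i : ℝ)) * ((γ i - x ^ 2) / (1 - x)) ≤ ((hi i : ℝ) - (lo i : ℝ)) * max ((γ i - x ^ 2) / (1 - x)) 0 :=
        mul_le_mul_of_nonneg_left (le_max_left _ _) hb
      linarith

/-- **CONJECTURE DIB\* FOR EVERY INSTANCE WHOSE LIGHT BLOBS TOTAL AT MOST `j`** (DIB\*'s own binder shape, `a`, `g`, `j` on one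
index type; any number of light blobs `g k < x`, every floor `0 < x < 1`):
`Σ_{k : g k < x} a k ≤ j` and `2j < Σ_k a k·(g k if x ≤ g k, else (g k − x²)/(1 − x))` ⟹ `x ≤ P(Σ_{k open} a k ≥ j+1)`.
(`DIBStar`/`DIBStarCorner` ask only `a k ≤ j` for each light blob; this is the sub-family of SMALL CLOUDS, the first kernel row of the
open corner with several non-mergeable light blobs.) [this work] -/
theorem dibStar_of_lightTotal_le (x : ℝ) (hx0 : 0 < x) (hx1 : x < 1) (a : κ → ℕ) (g : κ → ℝ) (j : ℕ)
    (hg : ∀ k, 0 ≤ g k ∧ g k ≤ 1)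
    (hsmall : ∑ k ∈ Finset.univ.filter (fun k => g k < x), a k ≤ j)
    (hcredit : (2 * j : ℝ) < ∑ k, (a k : ℝ) * (if x ≤ g k then g k else (g k - x ^ 2) / (1 - x))) :
    x ≤ ∑ W : Finset κ, (∏ k, if k ∈ W then g k else 1 - g k) * (if j + 1 ≤ ∑ k ∈ W, a k then (1 : ℝ) else 0) := by
  set L : Finset κ := Finset.univ.filter (fun k => g k < x) with hL
  have hmemL : ∀ k, k ∈ L ↔ g k < x := fun k => by simp [hL]
  refine tail_ge_of_smallCloud g a x hx0 hx1 (fun k => (hg k).1) (fun k => (hg k).2) L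
    (fun k hk => not_lt.1 fun h => hk ((hmemL k).2 h)) (fun k hk => ((hmemL k).1 hk).le) j hsmall ?_
  have hsplit : ∑ k, (a k : ℝ) * (if x ≤ g k then g k else (g k - x ^ 2) / (1 - x)) =
      (∑ k ∈ Finset.univ \ L, (a k : ℝ) * g k) + ∑ k ∈ L, (a k : ℝ) * ((g k - x ^ 2) / (1 - x)) := by
    rw [← Finset.sum_sdiff (Finset.subset_univ L)]
    congr 1
    · refine Finset.sum_congr rfl fun k hk => ?_
      have hkL : k ∉ L := (Finset.mem_sdiff.1 hk).2
      rw [if_pos (not_lt.1 fun h => hkL ((hmemL k).2 h))]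
    · refine Finset.sum_congr rfl fun k hk => ?_
      rw [if_neg (not_le.2 ((hmemL k).1 hk))]
  have hLsum : ∑ k ∈ L, (a k : ℝ) * ((g k - x ^ 2) / (1 - x)) =
      ((∑ k ∈ L, (a k : ℝ) * g k) - x ^ 2 * (∑ k ∈ L, (a k : ℝ))) / (1 - x) := by
    have e : ∀ k ∈ L, (a k : ℝ) * ((g k - x ^ 2) / (1 - x)) = ((a k : ℝ) * g k - x ^ 2 * (a k : ℝ)) / (1 - x) := by
      intro k _; ring
    rw [Finset.sum_congr rfl e, ← Finset.sum_div, Finset.sum_sub_distrib, ← Finset.mul_sum]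
  rw [hsplit, hLsum] at hcredit
  exact hcredit

end IndepBlob

end Quant

end Summit.CriticalPhenomena.PercolationContinuityZ3.Theorems
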